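import Literature.NumberTheory.EllipticCurves.WeierstrassDivisorClassPoints
import Literature.NumberTheory.EllipticCurves.FunctionFieldTranslation
import Literature.NumberTheory.DiophantineGeometry.FunctionFieldTraceResidueCharacter
import HarnessLib

/-!
# The characters `ψ ∘ x` and `ψ ∘ y` of the divisor group of an elliptic function field
(Kohel–Shparlinski, Thm. 1 for `f = x`, `f = y`: values, conductor `3·O` / `4·O`, nontriviality)

Topic `NumberTheory/EllipticCurves`. Arithmetic file of the discharge of the named fact
`Literature.NumberTheory.EllipticCurves.KohelShparlinski.CoordinateCharSumBound`. For an elliptic curve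
`V` over a field `k` with function field `k(V)`, place at infinity `∞ = infPlace V` and generic
coordinates `x = xF V`, `y = yF V`, the tree's trace-of-residues character
`traceResidueChar ψ ∞ f` (`FunctionFieldTraceResidueCharacter`: `D ↦ ψ(Σ_v D(v) Tr_{k_v/k}(f mod v))`)
is specialised to `f = x` and `f = y`:

* the local facts at `∞` and at the rational points: `xF_mem_of_ne_infPlace`, `yF_mem_of_ne_infPlace`
  (`x, y` are regular outside `∞`), `ord_infPlace_xF = -2`, `ord_infPlace_yF = -3`,
  `ord_infPlace_xF_div_yF = 1` (`x/y` is a uniformizer at `∞`), and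
  `valuation_xF_sub_lt_one`, `valuation_yF_sub_lt_one` (`x ≡ a`, `y ≡ b` at `placeOfPoint (a, b)`);
* **values**: `traceResidueChar ψ ∞ x (placeOfPoint (a,b)) = ψ a`,
  `traceResidueChar ψ ∞ y (placeOfPoint (a,b)) = ψ b` (`traceResidueChar_xF_single_placeOfPoint`,
  `traceResidueChar_yF_single_placeOfPoint`);
* **conductors** ([KohelShparlinski2000, Thm. 1]: `m = n + 1` for the pole `O` of order `n = 2, 3`):
  `traceResidueChar ψ ∞ x` kills the divisors of the ray functions `h ≡ 1 (mod 𝔪_∞³)` and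
  `traceResidueChar ψ ∞ y` those `≡ 1 (mod 𝔪_∞⁴)` (`…_principalDivisor_of_mem_ray`);
* **nontriviality** on a principal divisor prime to `∞` (degree `0`) when `ψ ≠ 1`: for `x` if `2 ≠ 0`
  in `k`, for `y` if `3 ≠ 0` in `k` (`exists_traceResidueChar_xF_ne_one`,
  `exists_traceResidueChar_yF_ne_one`) — the characteristic guards of the named fact;
* the **twisted characters** `coordChar ω ψ f := divisorChar ω · traceResidueChar ψ ∞ f`
  (`ω ∈ Hom(V(k), M)` read on divisors through the Abel–Jacobi map `pointOfDivisor` of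
  `WeierstrassDivisorClassPoints`): value `ω((a,b)) ψ(a)` resp. `ω((a,b)) ψ(b)` at `placeOfPoint (a,b)`,
  ray class characters modulo `3·∞` resp. `4·∞`, and nontrivial on a divisor of degree `0` prime to
  `∞` as soon as `ψ ≠ 1` (guards as above) or `ψ = 1`, `ω ≠ 1` and `#V(k) ≥ 3`
  (`exists_pointOfDivisor_eq`: every point is `pointOfDivisor` of a divisor of degree `0` prime to
  `∞`). These are the hypotheses `hval`, `hray`, `hnt` of
  `KohelShparlinski.coordinateCharSumBound_of_families` for the members of the Kohel–Shparlinski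
  family `(ω', ψ^c)`.

Everything is proved; the only definition is the abbreviation `coordChar`; no named facts.

## References

* D. R. Kohel, I. E. Shparlinski, *On exponential sums and group generators for elliptic curves over
  finite fields*, ANTS-IV, LNCS 1838 (2000), 395–404: Thm. 1 (p. 398), `deg x = 2`, `deg y = 3`
  (p. 398), Cor. 2 (p. 401, the guards `p ≠ 2`, `p ≠ 3`). [KohelShparlinski2000]
* J. H. Silverman, *The Arithmetic of Elliptic Curves*, 2nd ed., GTM 106, Prop. III.3.1
  (`ord_O x = -2`, `ord_O y = -3`). [SilvermanAEC2009]
-/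

noncomputable section

open scoped Classical Polynomial.Bivariate
open IsDedekindDomain WithZero Polynomial

namespace Literature.NumberTheory.EllipticCurves.KohelShparlinski

open Literature.NumberTheory.DiophantineGeometry
open AlgFunctionField WeierstrassPlaceAtInfinity WeierstrassFunctionField WeierstrassRationalPlaces
  WeierstrassDivisorClassPoints

universe u

variable {k : Type u} [Field k] (V : WeierstrassCurve.Affine k)

/-! ### `x` and `y` at the places of `k(V)` -/

/-- `x ≠ 0` in `k(V)`. [folklore] -/
theorem xF_ne_zero : xF V ≠ 0 := fun h => (transcendental_xF V) (h ▸ isAlgebraic_zero)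

/-- **`ord_∞ x = -2`.** [cite: SilvermanAEC2009, Prop. III.3.1] -/
theorem ord_infPlace_xF : (infPlace V).ord (xF V) = -2 := by
  rw [Literature.NumberTheory.EllipticCurves.WeierstrassPlaceAtInfinity.ord_infPlace_eq_neg_log _
    (xF_ne_zero V), show xF V = algebraMap k[X] V.FunctionField X from rfl, infValuationF_x, log_exp]

/-- `y ≠ 0` in `k(V)`. [folklore] -/
theorem yF_ne_zero : yF V ≠ 0 := by
  intro h
  have h3 := infValuationF_y V
  rw [show algebraMap V.CoordinateRing V.FunctionField (WeierstrassCurve.Affine.CoordinateRing.mk V Y) =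
    yF V from rfl, h, Valuation.map_zero] at h3
  exact WithZero.zero_ne_coe h3

/-- **`ord_∞ y = -3`.** [cite: SilvermanAEC2009, Prop. III.3.1] -/
theorem ord_infPlace_yF : (infPlace V).ord (yF V) = -3 := by
  rw [Literature.NumberTheory.EllipticCurves.WeierstrassPlaceAtInfinity.ord_infPlace_eq_neg_log _
    (yF_ne_zero V), show yF V = algebraMap V.CoordinateRing V.FunctionField
      (WeierstrassCurve.Affine.CoordinateRing.mk V Y) from rfl, infValuationF_y, log_exp]

/-- **`x/y` is a uniformizer at `∞`**: `ord_∞ (x/y) = 1`. [cite: SilvermanAEC2009, §IV.1] -/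
theorem ord_infPlace_xF_div_yF : (infPlace V).ord (xF V / yF V) = 1 := by
  rw [(infPlace V).ord_div (xF_ne_zero V) (yF_ne_zero V), ord_infPlace_xF, ord_infPlace_yF]; norm_num

/-- `x ∈ 𝔪_∞^{-2}`. [folklore] -/
theorem xF_mem_ball : xF V ∈ (infPlace V).ball (-(2 : ℕ) : ℤ) := by
  rw [(infPlace V).mem_ball_iff_le_ord _ (xF_ne_zero V), ord_infPlace_xF]; norm_num

/-- `y ∈ 𝔪_∞^{-3}`. [folklore] -/
theorem yF_mem_ball : yF V ∈ (infPlace V).ball (-(3 : ℕ) : ℤ) := by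
  rw [(infPlace V).mem_ball_iff_le_ord _ (yF_ne_zero V), ord_infPlace_yF]; norm_num

variable [V.IsElliptic]

/-- `x` is regular outside `∞`. [cite: SilvermanAEC2009, Prop. III.3.1] -/
theorem xF_mem_of_ne_infPlace {v : PlaceOver k V.FunctionField} (hv : v ≠ infPlace V) :
    xF V ∈ v.toValuationSubring := by
  rcases WeierstrassPlaces.eq_infPlace_or_exists_eq_ofPrime V v with rfl | ⟨𝔭, rfl⟩
  · exact absurd rfl hv
  · exact WeierstrassPlaces.x_mem_ofPrime V 𝔭

/-- `y` is regular outside `∞`. [cite: SilvermanAEC2009, Prop. III.3.1] -/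
theorem yF_mem_of_ne_infPlace {v : PlaceOver k V.FunctionField} (hv : v ≠ infPlace V) :
    yF V ∈ v.toValuationSubring := by
  rcases WeierstrassPlaces.eq_infPlace_or_exists_eq_ofPrime V v with rfl | ⟨𝔭, rfl⟩
  · exact absurd rfl hv
  · exact PlaceOver.algebraMap_mem_ofPrime 𝔭 _

variable {V}

/-- At the place of the rational point `(a, b)`: an element `r(x, y) ∈ k[V]` with `r(a, b) = 0` has
valuation `< 1`. [folklore] -/
theorem valuation_placeOfPoint_algebraMap_lt_one {a b : k} (h : V.Nonsingular a b) {p : k[X][Y]}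
    (hp : p.evalEval a b = 0) :
    (placeOfPoint V (.some a b h)).valuation
        (algebraMap V.CoordinateRing V.FunctionField (WeierstrassCurve.Affine.CoordinateRing.mk V p)) < 1 := by
  have hmem : WeierstrassCurve.Affine.CoordinateRing.mk V p ∈ (pointPrime h.left).asIdeal := by
    rw [pointPrime_asIdeal]; exact (mk_mem_pointIdeal_iff h.left p).2 hp
  have hlt : placeValuation V (.some a b h)
      (algebraMap V.CoordinateRing V.FunctionField (WeierstrassCurve.Affine.CoordinateRing.mk V p)) < 1 := by
    rw [placeValuation_some]
    exact (HeightOneSpectrum.valuation_lt_one_iff_mem _ _).2 hmem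
  exact ((isEquiv_placeValuation_valuation (V := V) (.some a b h)).lt_one_iff_lt_one).1 hlt

/-- **`x ≡ a` at `placeOfPoint (a, b)`.** [cite: SilvermanAEC2009, Prop. II.1.1] -/
theorem valuation_xF_sub_lt_one {a b : k} (h : V.Nonsingular a b) :
    (placeOfPoint V (.some a b h)).valuation (xF V - algebraMap k V.FunctionField a) < 1 := by
  have hx : xF V - algebraMap k V.FunctionField a =
      algebraMap V.CoordinateRing V.FunctionField
        (WeierstrassCurve.Affine.CoordinateRing.mk V (C (X - C a))) := by
    rw [map_sub C, map_sub (WeierstrassCurve.Affine.CoordinateRing.mk V),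
      map_sub (algebraMap V.CoordinateRing V.FunctionField), xF,
      IsScalarTower.algebraMap_apply k[X] V.CoordinateRing V.FunctionField X,
      IsScalarTower.algebraMap_apply k V.CoordinateRing V.FunctionField a]
    rfl
  rw [hx]
  exact valuation_placeOfPoint_algebraMap_lt_one h
    (by rw [Polynomial.evalEval_C, Polynomial.eval_sub, Polynomial.eval_X, Polynomial.eval_C, sub_self])

/-- **`y ≡ b` at `placeOfPoint (a, b)`.** [cite: SilvermanAEC2009, Prop. II.1.1] -/
theorem valuation_yF_sub_lt_one {a b : k} (h : V.Nonsingular a b) :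
    (placeOfPoint V (.some a b h)).valuation (yF V - algebraMap k V.FunctionField b) < 1 := by
  have hy : yF V - algebraMap k V.FunctionField b =
      algebraMap V.CoordinateRing V.FunctionField
        (WeierstrassCurve.Affine.CoordinateRing.mk V (Y - C (C b))) := by
    rw [map_sub (WeierstrassCurve.Affine.CoordinateRing.mk V),
      map_sub (algebraMap V.CoordinateRing V.FunctionField), yF,
      IsScalarTower.algebraMap_apply k V.CoordinateRing V.FunctionField b]
    rfl
  rw [hy]
  exact valuation_placeOfPoint_algebraMap_lt_one h (by simp)

/-! ### The characters `ψ ∘ x`, `ψ ∘ y`: values, conductors, nontriviality -/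

section Chars

variable {M : Type*} [CommMonoid M]

/-- **`(ψ ∘ x)(placeOfPoint (a, b)) = ψ(a)`.** [cite: KohelShparlinski2000, §1 (definition of S(ω,ψ,x))] -/
theorem traceResidueChar_xF_single_placeOfPoint (ψ : AddChar k M) {a b : k} (h : V.Nonsingular a b) :
    PlaceOver.traceResidueChar ψ (infPlace V) (xF V) (Finsupp.single (placeOfPoint V (.some a b h)) 1) =
      ψ a :=
  PlaceOver.traceResidueChar_single_one_eq ψ (placeOfPoint_some_ne_infPlace h)
    (isRational_placeOfPoint _) (xF_mem_of_ne_infPlace V (placeOfPoint_some_ne_infPlace h))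
    (valuation_xF_sub_lt_one h)

/-- **`(ψ ∘ y)(placeOfPoint (a, b)) = ψ(b)`.** [cite: KohelShparlinski2000, §1 (definition of S(ω,ψ,y))] -/
theorem traceResidueChar_yF_single_placeOfPoint (ψ : AddChar k M) {a b : k} (h : V.Nonsingular a b) :
    PlaceOver.traceResidueChar ψ (infPlace V) (yF V) (Finsupp.single (placeOfPoint V (.some a b h)) 1) =
      ψ b :=
  PlaceOver.traceResidueChar_single_one_eq ψ (placeOfPoint_some_ne_infPlace h)
    (isRational_placeOfPoint _) (yF_mem_of_ne_infPlace V (placeOfPoint_some_ne_infPlace h))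
    (valuation_yF_sub_lt_one h)

variable (V)

/-- **`ψ ∘ x` has conductor dividing `3·O`**: it kills `(h)` for `h ≡ 1 (mod 𝔪_∞³)`
([KohelShparlinski2000, Thm. 1]: `m ≤ n + 1 = 3`). [cite: KohelShparlinski2000, Thm. 1] -/
theorem traceResidueChar_xF_principalDivisor_of_mem_ray (ψ : AddChar k M) {h : V.FunctionField}
    (hray : h ∈ (infPlace V).ray 3) (hh : h ≠ 0) :
    PlaceOver.traceResidueChar ψ (infPlace V) (xF V) (principalDivisor k h) = 1 :=
  PlaceOver.traceResidueChar_principalDivisor_of_mem_ray ψ (infPlace V)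
    (fun _ hv => xF_mem_of_ne_infPlace V hv) (xF_mem_ball V) hray hh

/-- **`ψ ∘ y` has conductor dividing `4·O`**: it kills `(h)` for `h ≡ 1 (mod 𝔪_∞⁴)`
([KohelShparlinski2000, Thm. 1]: `m ≤ n + 1 = 4`). [cite: KohelShparlinski2000, Thm. 1] -/
theorem traceResidueChar_yF_principalDivisor_of_mem_ray (ψ : AddChar k M) {h : V.FunctionField}
    (hray : h ∈ (infPlace V).ray 4) (hh : h ≠ 0) :
    PlaceOver.traceResidueChar ψ (infPlace V) (yF V) (principalDivisor k h) = 1 :=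
  PlaceOver.traceResidueChar_principalDivisor_of_mem_ray ψ (infPlace V)
    (fun _ hv => yF_mem_of_ne_infPlace V hv) (yF_mem_ball V) hray hh

/-- **`ψ ∘ x` is nontrivial on a principal divisor prime to `∞`** if `ψ ≠ 1` and `2 ≠ 0` in `k`
(`x` has a pole of order `2` prime to `p` at `∞`; [KohelShparlinski2000, Thm. 1: `m = n + 1` iff
`(n, q) = 1`], and Cor. 2: "`f = x` if `p ≠ 2`"). [cite: KohelShparlinski2000, Thm. 1 and Cor. 2] -/
theorem exists_traceResidueChar_xF_ne_one {ψ : AddChar k M} (hψ : ψ ≠ 1) (h2 : (2 : k) ≠ 0) :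
    ∃ D₁ : Divisor k V.FunctionField, D₁ (infPlace V) = 0 ∧ D₁.degree = 0 ∧
      PlaceOver.traceResidueChar ψ (infPlace V) (xF V) D₁ ≠ 1 := by
  obtain ⟨h, hh0, hordh, hne⟩ := PlaceOver.exists_traceResidueChar_principalDivisor_ne_one hψ
    (isRational_infPlace V) (fun _ hv => xF_mem_of_ne_infPlace V hv) (m := 2) (by norm_num)
    (by exact_mod_cast h2) (xF_ne_zero V) (by rw [ord_infPlace_xF]; norm_num)
    (div_ne_zero (xF_ne_zero V) (yF_ne_zero V)) (ord_infPlace_xF_div_yF V)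
  refine ⟨principalDivisor k h, ?_, degree_principalDivisor_eq_zero hh0, hne⟩
  rw [principalDivisor_apply (finite_setOf_ord_ne_zero_holds hh0), hordh]

/-- **`ψ ∘ y` is nontrivial on a principal divisor prime to `∞`** if `ψ ≠ 1` and `3 ≠ 0` in `k`
(`y` has a pole of order `3` prime to `p` at `∞`; Cor. 2: "`f = y` if `p ≠ 3`").
[cite: KohelShparlinski2000, Thm. 1 and Cor. 2] -/
theorem exists_traceResidueChar_yF_ne_one {ψ : AddChar k M} (hψ : ψ ≠ 1) (h3 : (3 : k) ≠ 0) :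
    ∃ D₁ : Divisor k V.FunctionField, D₁ (infPlace V) = 0 ∧ D₁.degree = 0 ∧
      PlaceOver.traceResidueChar ψ (infPlace V) (yF V) D₁ ≠ 1 := by
  obtain ⟨h, hh0, hordh, hne⟩ := PlaceOver.exists_traceResidueChar_principalDivisor_ne_one hψ
    (isRational_infPlace V) (fun _ hv => yF_mem_of_ne_infPlace V hv) (m := 3) (by norm_num)
    (by exact_mod_cast h3) (yF_ne_zero V) (by rw [ord_infPlace_yF]; norm_num)
    (div_ne_zero (xF_ne_zero V) (yF_ne_zero V)) (ord_infPlace_xF_div_yF V)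
  refine ⟨principalDivisor k h, ?_, degree_principalDivisor_eq_zero hh0, hne⟩
  rw [principalDivisor_apply (finite_setOf_ord_ne_zero_holds hh0), hordh]

/-! ### Every rational point is the point of a divisor of degree `0` prime to `∞` -/

/-- **Every point is `pointOfDivisor` of a divisor of degree `0` prime to `∞`** when `#V(k) ≥ 3`:
`T = pt((2T) - (T))` if `2T ≠ O`, and `T = pt((T + T') - (T'))` for any `T' ∉ {O, T}` if `2T = O`.
(For `#V(k) ≤ 2` this can fail: `V(k) = {O, T}` has no divisor of degree `0` supported on affine
rational points.) [folklore] -/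
theorem exists_pointOfDivisor_eq (h3 : ∃ P₁ P₂ P₃ : V.Point, P₁ ≠ P₂ ∧ P₁ ≠ P₃ ∧ P₂ ≠ P₃)
    (T : V.Point) :
    ∃ D₁ : Divisor k V.FunctionField, D₁ (infPlace V) = 0 ∧ D₁.degree = 0 ∧ pointOfDivisor V D₁ = T := by
  rcases eq_or_ne T 0 with rfl | hT
  · exact ⟨0, rfl, map_zero _, map_zero _⟩
  -- a divisor `(P) - (P')` of two affine rational points
  have hpair : ∀ P P' : V.Point, P ≠ 0 → P' ≠ 0 →
      (Finsupp.single (placeOfPoint V P) 1 - Finsupp.single (placeOfPoint V P') 1 :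
        Divisor k V.FunctionField) (infPlace V) = 0 ∧
      Divisor.degree (Finsupp.single (placeOfPoint V P) 1 - Finsupp.single (placeOfPoint V P') 1 :
        Divisor k V.FunctionField) = 0 ∧
      pointOfDivisor V (Finsupp.single (placeOfPoint V P) 1 - Finsupp.single (placeOfPoint V P') 1) =
        P - P' := by
    intro P P' hP hP'
    have hne : ∀ Q : V.Point, Q ≠ 0 → placeOfPoint V Q ≠ infPlace V := fun Q hQ e =>
      hQ (placeOfPoint_injective (e.trans (placeOfPoint_zero (V := V)).symm))
    refine ⟨?_, ?_, ?_⟩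
    · rw [Finsupp.sub_apply, Finsupp.single_eq_of_ne (hne P hP).symm,
        Finsupp.single_eq_of_ne (hne P' hP').symm, sub_zero]
    · rw [map_sub, Divisor.degree_single, Divisor.degree_single, degree_placeOfPoint,
        degree_placeOfPoint, sub_self]
    · rw [map_sub, pointOfDivisor_single_placeOfPoint, pointOfDivisor_single_placeOfPoint, one_smul,
        one_smul]
  by_cases h2 : (2 : ℤ) • T ≠ 0
  · obtain ⟨h1, h2', h3'⟩ := hpair ((2 : ℤ) • T) T h2 hT
    exact ⟨_, h1, h2', by rw [h3']; abel⟩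
  · push Not at h2
    -- a third point `T' ∉ {O, T}`
    obtain ⟨T', hT'0, hT'T⟩ : ∃ T' : V.Point, T' ≠ 0 ∧ T' ≠ T := by
      obtain ⟨P₁, P₂, P₃, h12, h13, h23⟩ := h3
      by_cases a1 : P₁ ≠ 0 ∧ P₁ ≠ T
      · exact ⟨P₁, a1.1, a1.2⟩
      by_cases a2 : P₂ ≠ 0 ∧ P₂ ≠ T
      · exact ⟨P₂, a2.1, a2.2⟩
      refine ⟨P₃, fun e => ?_, fun e => ?_⟩ <;> push Not at a1 a2
      · rcases eq_or_ne P₁ 0 with e1 | e1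
        · exact h13 (e1.trans e.symm)
        · rcases eq_or_ne P₂ 0 with e2 | e2
          · exact h23 (e2.trans e.symm)
          · exact h12 ((a1 e1).trans (a2 e2).symm)
      · rcases eq_or_ne P₁ T with e1 | e1
        · exact h13 (e1.trans e.symm)
        · rcases eq_or_ne P₂ T with e2 | e2
          · exact h23 (e2.trans e.symm)
          · exact h12 ((a1.mt e1 |> not_not.mp).trans (a2.mt e2 |> not_not.mp).symm)
    have hTT' : T + T' ≠ 0 := by
      intro e
      have : T' = -T := by rw [← sub_eq_zero, sub_neg_eq_add, add_comm]; exact e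
      have hnegT : -T = T := by
        rw [neg_eq_iff_add_eq_zero, ← two_zsmul]; exact h2
      exact hT'T (this.trans hnegT)
    obtain ⟨h1, h2', h3'⟩ := hpair (T + T') T' hTT' hT'0
    exact ⟨_, h1, h2', by rw [h3']; abel⟩

/-! ### The twisted characters `ω · (ψ ∘ f)` -/

/-- **The Kohel–Shparlinski character** `χ = ω · (ψ ∘ f)` of the divisor group of `k(V)`:
`divisorChar ω` (the character `ω` of `V(k)` read through the Abel–Jacobi map, unramified) times the
trace-of-residues character `ψ ∘ f`. [cite: KohelShparlinski2000, Thm. 1 (the character ω · (ψ ∘ f))] -/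
abbrev coordChar (ω : AddChar V.Point M) (ψ : AddChar k M) (f : V.FunctionField) :
    AddChar (Divisor k V.FunctionField) M :=
  divisorChar V ω * PlaceOver.traceResidueChar ψ (infPlace V) f

variable {V}

/-- Value of `ω · (ψ ∘ x)` at `placeOfPoint (a, b)`: `ω((a,b)) ψ(a)`. [cite: KohelShparlinski2000, §1] -/
theorem coordChar_xF_single_placeOfPoint (ω : AddChar V.Point M) (ψ : AddChar k M) {a b : k}
    (h : V.Nonsingular a b) :
    coordChar V ω ψ (xF V) (Finsupp.single (placeOfPoint V (.some a b h)) 1) = ω (.some a b h) * ψ a := by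
  rw [coordChar, AddChar.mul_apply, divisorChar_single_placeOfPoint, traceResidueChar_xF_single_placeOfPoint]

/-- Value of `ω · (ψ ∘ y)` at `placeOfPoint (a, b)`: `ω((a,b)) ψ(b)`. [cite: KohelShparlinski2000, §1] -/
theorem coordChar_yF_single_placeOfPoint (ω : AddChar V.Point M) (ψ : AddChar k M) {a b : k}
    (h : V.Nonsingular a b) :
    coordChar V ω ψ (yF V) (Finsupp.single (placeOfPoint V (.some a b h)) 1) = ω (.some a b h) * ψ b := by
  rw [coordChar, AddChar.mul_apply, divisorChar_single_placeOfPoint, traceResidueChar_yF_single_placeOfPoint]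

variable (V)

/-- `ω · (ψ ∘ x)` is a ray class character modulo `3·∞`. [cite: KohelShparlinski2000, Thm. 1] -/
theorem coordChar_xF_principalDivisor_of_mem_ray (ω : AddChar V.Point M) (ψ : AddChar k M)
    {h : V.FunctionField} (hray : h ∈ (infPlace V).ray 3) (hh : h ≠ 0) :
    coordChar V ω ψ (xF V) (principalDivisor k h) = 1 := by
  rw [coordChar, AddChar.mul_apply, divisorChar_principalDivisor,
    traceResidueChar_xF_principalDivisor_of_mem_ray V ψ hray hh, one_mul]

/-- `ω · (ψ ∘ y)` is a ray class character modulo `4·∞`. [cite: KohelShparlinski2000, Thm. 1] -/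
theorem coordChar_yF_principalDivisor_of_mem_ray (ω : AddChar V.Point M) (ψ : AddChar k M)
    {h : V.FunctionField} (hray : h ∈ (infPlace V).ray 4) (hh : h ≠ 0) :
    coordChar V ω ψ (yF V) (principalDivisor k h) = 1 := by
  rw [coordChar, AddChar.mul_apply, divisorChar_principalDivisor,
    traceResidueChar_yF_principalDivisor_of_mem_ray V ψ hray hh, one_mul]

/-- **Nontriviality of `ω · (ψ ∘ f)` when `ψ ≠ 1`**: on the principal divisor prime to `∞` on which
`ψ ∘ f` is nontrivial, `divisorChar ω` is trivial. [cite: KohelShparlinski2000, Thm. 1] -/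
theorem exists_coordChar_ne_one_of_ne_one (ω : AddChar V.Point M) {ψ : AddChar k M} {f : V.FunctionField}
    (hex : ∃ h : V.FunctionField, h ≠ 0 ∧ (infPlace V).ord h = 0 ∧
      PlaceOver.traceResidueChar ψ (infPlace V) f (principalDivisor k h) ≠ 1) :
    ∃ D₁ : Divisor k V.FunctionField, D₁ (infPlace V) = 0 ∧ D₁.degree = 0 ∧ coordChar V ω ψ f D₁ ≠ 1 := by
  obtain ⟨h, hh0, hordh, hne⟩ := hex
  refine ⟨principalDivisor k h, ?_, degree_principalDivisor_eq_zero hh0, ?_⟩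
  · rw [principalDivisor_apply (finite_setOf_ord_ne_zero_holds hh0), hordh]
  · rwa [coordChar, AddChar.mul_apply, divisorChar_principalDivisor, one_mul]

/-- **Nontriviality of `ω · (ψ ∘ x)`, `ψ ≠ 1`, `2 ≠ 0`.** [cite: KohelShparlinski2000, Thm. 1 and Cor. 2] -/
theorem exists_coordChar_xF_ne_one (ω : AddChar V.Point M) {ψ : AddChar k M} (hψ : ψ ≠ 1)
    (h2 : (2 : k) ≠ 0) :
    ∃ D₁ : Divisor k V.FunctionField, D₁ (infPlace V) = 0 ∧ D₁.degree = 0 ∧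
      coordChar V ω ψ (xF V) D₁ ≠ 1 :=
  exists_coordChar_ne_one_of_ne_one V ω
    (PlaceOver.exists_traceResidueChar_principalDivisor_ne_one hψ (isRational_infPlace V)
      (fun _ hv => xF_mem_of_ne_infPlace V hv) (m := 2) (by norm_num) (by exact_mod_cast h2)
      (xF_ne_zero V) (by rw [ord_infPlace_xF]; norm_num) (div_ne_zero (xF_ne_zero V) (yF_ne_zero V))
      (ord_infPlace_xF_div_yF V))

/-- **Nontriviality of `ω · (ψ ∘ y)`, `ψ ≠ 1`, `3 ≠ 0`.** [cite: KohelShparlinski2000, Thm. 1 and Cor. 2] -/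
theorem exists_coordChar_yF_ne_one (ω : AddChar V.Point M) {ψ : AddChar k M} (hψ : ψ ≠ 1)
    (h3 : (3 : k) ≠ 0) :
    ∃ D₁ : Divisor k V.FunctionField, D₁ (infPlace V) = 0 ∧ D₁.degree = 0 ∧
      coordChar V ω ψ (yF V) D₁ ≠ 1 :=
  exists_coordChar_ne_one_of_ne_one V ω
    (PlaceOver.exists_traceResidueChar_principalDivisor_ne_one hψ (isRational_infPlace V)
      (fun _ hv => yF_mem_of_ne_infPlace V hv) (m := 3) (by norm_num) (by exact_mod_cast h3)
      (yF_ne_zero V) (by rw [ord_infPlace_yF]; norm_num) (div_ne_zero (xF_ne_zero V) (yF_ne_zero V))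
      (ord_infPlace_xF_div_yF V))

/-- **Nontriviality of `ω · (1 ∘ f) = divisorChar ω` when `ω ≠ 1` and `#V(k) ≥ 3`.** [folklore] -/
theorem exists_coordChar_one_ne_one {ω : AddChar V.Point M} (hω : ω ≠ 1)
    (h3 : ∃ P₁ P₂ P₃ : V.Point, P₁ ≠ P₂ ∧ P₁ ≠ P₃ ∧ P₂ ≠ P₃) (f : V.FunctionField) :
    ∃ D₁ : Divisor k V.FunctionField, D₁ (infPlace V) = 0 ∧ D₁.degree = 0 ∧
      coordChar V ω (1 : AddChar k M) f D₁ ≠ 1 := by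
  obtain ⟨T, hT⟩ : ∃ T : V.Point, ω T ≠ 1 := by
    by_contra hall
    push Not at hall
    exact hω (by ext T; exact hall T)
  obtain ⟨D₁, h1, h2, h3'⟩ := exists_pointOfDivisor_eq V h3 T
  refine ⟨D₁, h1, h2, ?_⟩
  have htriv : PlaceOver.traceResidueChar (1 : AddChar k M) (infPlace V) f = 1 := by
    ext D; rfl
  rw [coordChar, htriv, mul_one, divisorChar_apply, h3']
  exact hT

end Chars

end Literature.NumberTheory.EllipticCurves.KohelShparlinski
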